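import Mathlib
import HarnessLib
import HarnessLib.Audit
import Summits.CriticalPhenomena.Statement
import Literature.Probability.RandomPlanarGeometry.CrossingCondition
import Literature.Probability.RandomPlanarGeometry.SAWParafermion
import Literature.Probability.RandomPlanarGeometry.SLEConvergenceCriterion

/-!
Route: SAWParafermion

CLOSED (refuted) 2026-08-17T13:42:04Z by gate — reason: refuted:stmt-CriticalPhenomena-0772 (Tight) by Summit.CriticalPhenomena.SAWScalingLimit.Theorems.SAWParafermionTight_refuted — note: repair grace of 72.0 h (deadline 2026-08-17T13:39:52Z) expired without a repair — closed by the gate. The file is kept as the record of this route; refuted decls are indexed as negative knowledge (`ledger negatives`).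

# Route SAWParafermion — SAW to SLE(8/3) on Z^2 via the 5/8-parafermionic observable,
admissible-domain G1 tightness and the LSW martingale

It suffices to show X2 = (T) ∧ (I) [precompactness + identification, the Kemppainen–Smirnov /
martingale-observable scheme]:
(T) EventualTight (stmt-CriticalPhenomena-1881, the REPAIRED r4): for every Dobrushin domain and
endpoint approximation the critical δℤ² SAW laws pushed to CurveClass ℂ are tight ALONG THE MESH
FILTER 𝓝[>]0 (Literature.Probability.RandomPlanarGeometry.IsTightAlongMesh). The all-δ form Tight
(stmt-CriticalPhenomena-0772, IsTightLaws over δ ∈ (0,1]) is REFUTED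
(Theorems.SAWParafermionTight_refuted: IsEndpointApprox only constrains δ → 0⁺; far coincident
endpoints at δ ∈ (1/2,1] give Dirac laws escaping every compact) and stays listed only because the
gate bookkeeping below blocks its drop; it is settled negative knowledge (never re-wanted) and the
eventual form is the repair the refuting theorem prescribes.
(I) SubseqIdentification (stmt-CriticalPhenomena-0783): along every sequence δ_n → 0⁺, every weak
(probability) limit μ of the SAW laws in (Ω_δ; a_δ, b_δ) is the chordal SLE_{8/3} law in (Ω; a, b)
(Literature.Probability.RandomPlanarGeometry.IsSLELaw (8/3) D μ).
The physical crux behind (I) is r2 ObservableLimit: the square-lattice SAW parafermionic observable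
with spin σ = 5/8 satisfies (F_δ(z,w)+F_δ(w,z))/F_δ(b_δ,b'_δ) → (φ'(z)/φ'(b))^{5/8} —
Duminil-Copin–Smirnov 2012 Conjecture 2 transposed from the hexagonal lattice to δℤ²; a conformally
covariant martingale observable identifies the driving process of any subsequential limit as
√(8/3)·B (LSW03 Prop. 5.2). The engine behind (T) is r5 KSAdmissibleG1: Kemppainen–Smirnov's
time-zero Condition G1 (arXiv:1212.6215 eq. (4)) for the domain-Markov-stable ADMISSIBLE family of
critical SAW laws in all simply connected polyomino cell domains between boundary vertices (KS's own
reduction of Condition G2, §4.1.6), which gives (T) by KS Thm 1.5 (tightness after uniformisation)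
pulled back to Ω̄ by the Carathéodory extension of the Riemann map. It SUPERSEDES the earlier typing
KSConditionG2 (stmt-CriticalPhenomena-0791: G2 with U = D.carrier and polyline pasts; still listed
as support, to be dropped with the bookkeeping fix below), misstated on the planner's audit: a past
that runs along the first boundary layer and then builds a wall into the interior leaves a
vertex-free continuum corridor along ∂Ω, so the quarter-annulus beside the wall is 'unforced' (KS
Def. 2.3) while every lattice continuation must cross it — conditional probability 1, at every mesh,
in every Jordan domain.
DECIDING THEOREM (rev 10, 2026-08-15T19:05Z, authority native, ok; route STAFFABLE — 0 unproved deps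
in the cone of 107 constants): closes (hI : SubseqIdentification) (hT : EventualTight) (hA :
Assembly) : SAWScalingLimit := hA hI hT, where Assembly (stmt-CriticalPhenomena-0784) was RE-SIGNED
2026-08-15T19:03Z (workitem set-signature; check stamp reset) from the rev-1 form
'CurveClass.polishSpace → IsSLECurve.map_eq → exists_isSLECurve → Tight → SubseqIdentification →
SAWScalingLimit' (VACUOUS once Tight was refuted, and the only item pulling the cite-only fact
exists_isSLECurve into the cone) to the frame Assembly := SubseqIdentification → EventualTight →
SAWScalingLimit, exactly the retype refuters g28-1/g28-6/g37-0 and the reground/retriage stamps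
demanded (its informal gloss in the item record still shows the rev-1 wording; the signature is
authoritative). Assembly is provable now (~150 lines) as the SAW instance of the PROVED Prokhorov
criterion convergesInLawToSLE_of_isTightAlongMesh' (huniq := IsSLECurve.map_eq_holds, hY :=
SAW.aemeasurable_curve; eventual-probability patch of SAW.law at junk meshes via
IsEndpointApprox.reachable — grounder g20-4 2026-08-15T18:13Z), i.e. via the content of Assembly2
(stmt-CriticalPhenomena-10209 = SAWQuadrupoleWard.TightnessCriterion) followed by `fun D a b hab =>
crit D a b hab (hT D a b hab) (fun μ hμ ⟨s, hs, hf⟩ => hI D a b hab s μ hs hμ hf)`. r2 and r5 enter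
only through the undecomposed implications r2 ⇒ r3, r5 ⇒ r4.
STATUS 2026-08-15T19:10Z (route-repair seat rfix-…-ee424620-g2) — BROKEN ONLY IN BOOKKEEPING.
Mathematics and glue are repaired (EventualTight replaces Tight; Assembly is the honest frame;
closes certified native; cone clean). What keeps the BROKEN flag: the refuted Tight (stmt-0772) is
still an ACTIVE want, and every verb that would deactivate it (--drop Tight, --restate Tight) is
bounced by D-0019 route.multi-assembly because the route carries TWO assembly-kind wants — Assembly
(stmt-0784, the hypothesis of closes) and the now-redundant Assembly2 (stmt-10209, attached
2026-08-15T15:27Z by `workitem add` with an [assembly] tag; in substance a SUPPORT lemma, alive as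
SAWQuadrupoleWard.TightnessCriterion) — while the gate refuses --drop / --retriage of any
assembly-kind want ('the assembly item cannot be dropped / retriaged') and refuses restating
Assembly2 onto Assembly's statement ('items are shared by statement; drop one or reuse it' — and
that drop is refused). Re-verified 2026-08-15T18:49–19:12Z, 8 variants, all atomic bounces except
the two closes-only edits (accepted as rev 9/10, repair.repaired = false): log in evidence
REPAIR_STATE_rfix_g2.md (+ gen-1: 14 variants, REPAIR_PLAN_rfix.md). OPERATOR — one privileged
change unblocks everything: deactivate (drop) the want of stmt-CriticalPhenomena-10209 for this
route, or set its wanted_by.kind to 'support'. THEN (any planner seat): `ledger route edit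
route-CriticalPhenomena-SAWParafermion --drop Tight --note 'repair: Tight refuted-misstated by
Theorems.SAWParafermionTight_refuted; TightR = EventualTight (stmt-1881)'` (closes stays as landed
in rev 10), then `--drop KSConditionG2` (stmt-0791, superseded by KSAdmissibleG1 stmt-11346;
planner-audited misstated via the boundary-layer corridor) and `--drop stmt-CriticalPhenomena-4538`
(textual-twin frame of SAWRenewalTightness.Assembly, whose EventualTight is stmt-1372, not this
route's stmt-1881). Gate-rule fix that dissolves this class of knot: allow --drop/ --retriage of an
assembly-kind want whenever another assembly-kind want of the same route stays active (and stop
parsing an [assembly] tag on `workitem add` into a second assembly want). CAVEAT for whoever drops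
Tight: the re-rendered file loses `def Tight`, which orphans
Theorems/SAWParafermionTightRefutation.lean (typed ¬ SAWParafermion.Tight) exactly as
Theorems/SAWEdgeOfPositiveTypeInfiniteDivisibilityRefutation.lean has been orphaned since that
route's drop at 16:57Z (lean check: Unknown identifier) — keep rendering refuted decls that are
targets of a negative edge, or re-point the refutation file first. DEADLINE 2026-08-17T13:39:52Z:
nothing load-bearing is refuted; if no operator acts, the last repair seat before the deadline
should `ledger route close route-CriticalPhenomena-SAWParafermion --as retired --note 'bookkeeping
deadlock, line intact; re-file from card'` rather than let it auto-close 'refuted' (r2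
ObservableLimit stmt-0790 and r5 KSAdmissibleG1 stmt-11346 are UNIQUE to this route and would be
mooted).
Lean: `(∀ (D : Literature.Probability.RandomPlanarGeometry.DobrushinDomain) (a b : ℝ →
Literature.Probability.LatticeModels.Site 2),
Literature.Probability.RandomPlanarGeometry.SAW.IsEndpointApprox D a b →
Literature.Probability.RandomPlanarGeometry.IsTightAlongMesh (fun δ (γ :
Literature.Probability.RandomPlanarGeometry.SAW.DomainSAW D.carrier δ (a δ) (b δ)) => γ.curve) (fun
δ => Literature.Probability.RandomPlanarGeometry.SAW.law D.carrier δ (a δ) (b δ))) ∧ (∀ (D :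
Literature.Probability.RandomPlanarGeometry.DobrushinDomain) (a b : ℝ →
Literature.Probability.LatticeModels.Site 2),
Literature.Probability.RandomPlanarGeometry.SAW.IsEndpointApprox D a b → ∀ (s : ℕ → ℝ) (μ :
MeasureTheory.Measure (Literature.Probability.RandomPlanarGeometry.CurveClass ℂ)), Filter.Tendsto s
Filter.atTop (nhdsWithin 0 (Set.Ioi 0)) → MeasureTheory.IsProbabilityMeasure μ → (∀ f :
BoundedContinuousFunction (Literature.Probability.RandomPlanarGeometry.CurveClass ℂ) ℝ,
Filter.Tendsto (fun n => ∫ γ, f γ.curve ∂(Literature.Probability.RandomPlanarGeometry.SAW.law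
D.carrier (s n) (a (s n)) (b (s n)))) Filter.atTop (nhds (∫ x, f x ∂μ))) →
Literature.Probability.RandomPlanarGeometry.IsSLELaw ((8 : NNReal) / 3) D μ)`

## Assembly
Pure logic: Assembly := SubseqIdentification → EventualTight → SAWScalingLimit (stmt-0784, re-signed
rev 10) is exactly modus ponens of the deciding theorem closes (hI) (hT) (hA : Assembly) := hA hI
hT; the mathematical content of Assembly is the Prokhorov instance Assembly2 (stmt-10209: Prokhorov
+ uniqueness of the SLE law + the germ clamp; a SUPPORT lemma in substance, still badged assembly
until the bookkeeping knot is cut), from which Assembly follows in four lines. r2 (ObservableLimit)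
and r5 (KSAdmissibleG1) are the engines for r3 and r4 and enter only through the undecomposed
implications r2 ⇒ r3 (LSW03 Prop. 5.2 martingale identification, template
isSLELaw_of_isLocalMartingale_driving_of_lt_four) and r5 ⇒ r4 (SAW domain Markov ⇒ Condition G2 in
substance ⇒ KS Thm 1.5 ⇒ Carathéodory pull-back).

Rationale: WHY THIS LINE. Every proved interface→SLE theorem (percolation/SLE₆, Ising/SLE₃,
FK-Ising/SLE_{16/3}, LERW/SLE₂) goes through (a) a discrete observable with a conformally covariant
scaling limit and (b) a priori crossing estimates giving precompactness (Kemppainen–Smirnov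
arXiv:1212.6215, Thm 1.5 and §4). For the SAW, Duminil-Copin–Smirnov (arXiv:1007.0575) exhibit the
parafermionic observable with σ = 5/8 which on the HEXAGONAL lattice satisfies half of the discrete
Cauchy–Riemann relations (Lemma 1) — enough for μ_hex = √(2+√2) but "insufficient to deduce the
existence of such a limit … F_δ … seems to have non-trivial curl" (p.10) — and state the observable
conjecture (Conjecture 2) whose proof "would be a major step toward Conjecture 1". This route
transposes that programme to δℤ² (the lattice of the conjunct), where NO partial discrete
holomorphicity is known and integrability is not expected (Glazman–Manolescu arXiv:1708.00395 p.1);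
the observable conjecture is nevertheless meaningful (a statement about the limit, not about exact
lattice identities). Areas imported: discrete complex analysis / Riemann–Hilbert boundary value
problems (DCS eq. (9)), Loewner-chain tightness theory (KS), martingale identification (LSW03 Prop.
5.2). New object posited: the ℤ² SAW parafermionic (vertex or mid-edge) observable (defn
SAW.midEdgeParafermionicObservable landed); the construction is elementary (finite sum), no
existence is smuggled. REPAIR (2026-08-15, this revision): the all-δ tightness item Tight
(stmt-CriticalPhenomena-0772, IsTightLaws over δ ∈ (0,1]) was REFUTED AS TYPED (misstated:
IsEndpointApprox only constrains δ → 0⁺; witness = far coincident endpoints at δ ∈ (1/2,1], Dirac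
laws escaping compacts). It stays listed (closed, refuted) until the bookkeeping knot recorded in
the thesis STATUS block is cut by the operator (two assembly-kind wants, stmt-0784 vacuous +
stmt-10209; every planner verb that would drop, re-badge or merge one is refused and every
item-changing edit bounces route.multi-assembly — 14 variants tested 2026-08-15). Its content is
carried by the eventual item EventualTight (stmt-CriticalPhenomena-1881, IsTightAlongMesh, shared
with 12 sibling SAW routes); the rev-1 Assembly (stmt-0784, vacuous once Tight was refuted) has been
RE-SIGNED (rev 10) to the frame SubseqIdentification → EventualTight → SAWScalingLimit, and the
landed deciding theorem `closes` (SubseqIdentification, EventualTight, Assembly ⊢ SAWScalingLimit :=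
hA hI hT, native ok) decides the sub-problem literally; the Prokhorov instance Assembly2
(stmt-CriticalPhenomena-10209) is its proof plan and is to be re-badged support / detached the
moment the bookkeeping knot (thesis STATUS) is cut.

RANKED CRUXES. #2 ObservableLimit (crux) — r2 (hardest, most informative): Duminil-Copin–Smirnov
2012 Conjecture 2 transposed to δℤ² — for a Dobrushin domain with ∂Ω smooth near b, the
boundary-normalised critical mid-edge parafermionic observable (σ = 5/8, walks from a_δ not using
the marked edge, winding to the medial point) satisfies (F_δ(z,w)+F_δ(w,z))/F_δ(b_δ,b'_δ) →
exp((5/8)·L(z₀)) as δ → 0⁺, L a continuous logarithm of Φ'/c on Ω with L → 0 at b (κ = 1 boundary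
normalisation; shared statement stmt-CriticalPhenomena-0790). [difficulty: open-problem] (why it
might fail: Open even on hex (DCS12 §4: 'non-trivial curl'); no exact Z² vertex relation
(not_hasExactVertexRelationZ2). Typed with κ=1: boundary lattice effects persist in the SAW limit
via a tangent-angle factor l(θ) (KennedyLawler2013), so F(z_δ)/F(b_δ) may converge only up to a
b-dependent constant.) [DuminilCopinSmirnov2012, KennedyLawler2013, BeatonGuttmannJensen2012,
GlazmanManolescu2019, Literature.Barriers.CriticalPhenomena.not_hasExactVertexRelationZ2,
arXiv:1007.0575]
#3 SubseqIdentification (crux) — r3: identification of subsequential limits — for every Dobrushin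
domain, endpoint approximation, sequence s_n → 0⁺ and probability measure μ on CurveClass ℂ, if ∫
f∘curve d(SAW.law …(s n)…) → ∫ f dμ for all bounded continuous f then IsSLELaw (8/3) D μ (shared
stmt-CriticalPhenomena-0783; obtained from r2 by the LSW03 Prop. 5.2 martingale principle, or by
sibling routes' engines). [deps: ObservableLimit] [difficulty: open-problem] (why it might fail:
Unconditional over arbitrary subsequential μ: print gives SLE_{8/3} only IF the limit is conformally
covariant (LSW04 p.7, Prediction 1); on Z² the only embedding-sensitive inputs are r2 (open even on
hex) or restriction-of-limit; embedding-blind arguments cannot give rotations (Beffara2008).)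
[LawlerSchrammWerner2004SAW, LawlerSchrammWerner2003, DuminilCopinSmirnov2012, Beffara2008,
Literature.Barriers.CriticalPhenomena.EmbeddingModulusUniqueness, arXiv:math/0204277]
#4 EventualTight (crux) — r4 (REPAIRED Tight): eventual tightness of the critical SAW curve laws —
for every Dobrushin domain and endpoint approximation, IsTightAlongMesh (fun δ γ ↦ γ.curve) (fun δ ↦
SAW.law D.carrier δ (a δ) (b δ)) (shared stmt-CriticalPhenomena-1881; the all-δ stmt-0772 is refuted
and dropped). [deps: KSAdmissibleG1] [difficulty: open-problem] (why it might fail: Open for SAW: no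
annulus-crossing/RSW bound at x_c in print (KS17 §4 verifies G2 for FK, percolation, HE, LERW only;
§4.5 fails for UST); sub-ballisticity (DCH13; arXiv:2310.17299 hex) is the strongest input; r5⇒r4
needs KS Thm 1.5 pulled back from 𝔻 (Carathéodory), starts only o(1)-close to ∂Ω.)
[KemppainenSmirnov2017, AizenmanBurchardDuke1999, DuminilCopinHammond2013, arXiv:2310.17299,
Summit.CriticalPhenomena.SAWScalingLimit.Theorems.SAWParafermionTight_refuted,
Literature.Probability.RandomPlanarGeometry.IsTightAlongMesh]
#5 KSAdmissibleG1 (crux) — r5 (RESTATED; supersedes KSConditionG2 = stmt-CriticalPhenomena-0791):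
Kemppainen–Smirnov's time-zero Condition G1 for the admissible family — there is C > 1 such that for
every finite S ⊆ ℤ² inducing a connected subgraph with connected complement, every δ > 0, all
boundary vertices a, b of S and every annulus A(z₀, r, R) with R ≥ C r, the critical SAW in S from a
to b (SAW.law of the plain square-cell domain U(S,δ) = interior ⋃_{v∈S} closed δ-squares) makes a
crossing of A inside the avoidable part A^u (KS eq. (3), computed in U(S,δ)) with probability ≤ 1/2.
KS's own reduction (§4.1.6): the SAW's exact domain Markov property S ↦ S ∖ {v₀,…,v_{k-1}} keeps the
family stable, so this is Condition G2 in substance, with no stopping and no polyline-vs-continuum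
corridor artefacts (the past's cells are removed). [difficulty: open-problem] (why it might fail: No
RSW/FKG at n=0 (KS17 §4 verifies G-conditions for FK, percolation, HE, LERW; UST fails G2, §4.5); a
long-confined critical SAW's deep-fjord re-entry must stay ≤1/2 uniformly over ALL polyominoes and
all scales ≥ δ; only sub-ballisticity (DCH13) is unconditional.) [KemppainenSmirnov2017,
arXiv:1212.6215, DuminilCopinHammond2013, arXiv:1707.09335, MadrasSlade1993,
Literature.Probability.RandomPlanarGeometry.ConditionG1]
#9 NoExactVertexRelation (support) — refutation guard (shared stmt-CriticalPhenomena-0792): the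
uniform-weight ℤ² mid-edge observable satisfies NO exact local linear (DCS-Lemma-1-type) relation at
any (x, σ) with a fixed 4-stencil — the in-tree theorem
Literature.Barriers.CriticalPhenomena.not_hasExactVertexRelationZ2 up to unfolding; steers provers
of r2 to approximate/limit statements. [difficulty: provable-now]
[Literature.Barriers.CriticalPhenomena.not_hasExactVertexRelationZ2, GlazmanManolescu2019,
IkhlefCardy2009]
#9 Assembly2 (support) — the pointwise SAW instance of the PROVED Prokhorov criterion (shared
stmt-CriticalPhenomena-10209 = TightnessCriterion of route SAWQuadrupoleWard; carried here as the
second assembly-kind entry Assembly2 — in substance a SUPPORT lemma; re-badge PENDING, operator):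
for every (D,a,b) with IsEndpointApprox, IsTightAlongMesh of the curve laws and (every subsequential
weak limit law that is a probability measure is IsSLELaw (8/3) D) imply ConvergesInLawToSLE (8/3) D.
Provable now (~150 lines): clamp SAW.law to probability measures agreeing with it on the germ
(IsEndpointApprox.reachable ⇒ weight univ ≥ x_c^n > 0 by SAW.criticalFugacity_pos_lt_one'; DomainSAW
finite via meshDomain_finite ⇒ weight univ < ⊤), push forward to CurveClass ℂ with Y = id and a
Dirac at junk meshes, apply convergesInLawToSLE_of_isTightAlongMesh' (huniq :=
IsSLECurve.map_eq_holds, hY := SAW.aemeasurable_curve), transfer through eventual equality along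
𝓝[>]0. Assembly follows from it in four lines. [difficulty: provable-now]
[Literature.Probability.RandomPlanarGeometry.convergesInLawToSLE_of_isTightAlongMesh',
Literature.Probability.RandomPlanarGeometry.IsSLECurve.map_eq_holds,
Literature.Probability.RandomPlanarGeometry.SAW.aemeasurable_curve, BillingsleyCPM1999]

TWO-LAYER PLAN. Foreseen glued splits (filed only after a crux moves): SubseqIdentification ⇐
ObservableLimit → SimpleLoewnerLimits → SubseqIdentification (martingale identification of the
driving process, κ < 4 template PROVED in tree); EventualTight ⇐ KSAdmissibleG1 →
AdmissibleComparison → EventualTight (AdmissibleComparison: the SAW law of (D.carrier, δ, a_δ, b_δ)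
versus admissible polyomino members — Ω_δ of a Jordan domain need not be the induced subgraph on
meshDomain and a_δ, b_δ are only o(1)-close to ∂Ω — plus KS Thm 1.5 as a named fact and the
Carathéodory pull-back).

KILL CRITERIA. A refutation of r3 (a subsequential limit that is not SLE_{8/3}, e.g. anisotropic)
kills the conjunct. A refutation of r2 with r3 still open only kills the observable tool (pivot:
restriction / excursion-kernel / stress-tensor identification, sibling routes sharing r3, r4).
¬EventualTight for some (D, a_δ, b_δ) kills the conjunct in substance: along any mesh SEQUENCE a
family converging in law to a probability measure on the Polish space CurveClass ℂ is tight
(Prokhorov converse / LeCam), so mass escaping compacts along δ_n → 0⁺ contradicts SAWScalingLimit;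
only the sequence-vs-filter bookkeeping separates ¬r4 from ¬Statement. ¬KSAdmissibleG1 (a polyomino,
scale and annulus where the critical SAW makes an avoidable crossing with probability > 1/2 for
every C — e.g. deep-fjord re-entry after long confinement) kills the KS engine for r4 but not the
conjunct (pivot: Aizenman– Burchard traversal bounds, route SAWLeftRightFKG's SAWTraversalBound →
TraversalBoundTight, PROVED AB criterion). The refuted all-δ Tight (stmt-0772) is settled negative
knowledge and is never re-wanted.

NOT DECOMPOSED YET. the Riemann–Hilbert BVP analysis (DCS eq. (9)) on ℤ² behind r2; the
martingale-observable ⇒ driving-process argument r2 ⇒ r3 (template: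
isSLELaw_of_isLocalMartingale_driving_of_lt_four, PROVED, + KS Cor 1.7 Loewner regularity of
subsequential limits, which also wants r5); the implication r5 ⇒ r4 (SAW domain Markov ⇒ G2 for the
admissible family; KS Thm 1.5 as a named fact; comparison of Ω_δ with induced polyomino members;
Carathéodory pull-back) — to be filed as glued splits only after r2 or r5 moves; radial/bulk
variants (LSW04 Prediction 4–5) out of scope. Sources: DuminilCopinSmirnov2012 (Lemma 1, Conj. 1–2),
KemppainenSmirnov2017 = arXiv:1212.6215 (Thm 1.5, Cor 1.7–1.8, §2.1.3, Remark 2.2, §4),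
LawlerSchrammWerner2003 = arXiv:math/0209343 (Prop 5.2), arXiv:1708.00395,
LawlerSchrammWerner2004SAW, AizenmanBurchardDuke1999, DuminilCopinHammond2013, BillingsleyCPM1999
(Thm 5.1–5.2).

CHEAPEST FALSIFIER. For r2 (the load-bearing bet): exact enumeration / transfer-matrix evaluation of
the boundary- normalised mid-edge observable ratio (F_δ(z,w)+F_δ(w,z))/F_δ(b,b') in lattice
rectangles and slit rectangles up to ~10×10 at x_c ∈ [0.379052 ± 1e-6], σ = 5/8, compared with
(φ'(z)/φ'(b))^{5/8}: a ratio drifting to a b-dependent constant ≠ 1 (Kennedy–Lawler boundary factor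
l(θ)) or an interior phase defect not decaying with the size retires the κ = 1 normalisation of r2
(restate with a boundary-angle factor) before any analysis is attempted. For r5: exact enumeration /
Kennedy-pivot sampling of critical SAW in L-shaped and comb polyominoes between boundary vertices,
empirical frequency of avoidable crossings of boundary annuli of ratio 4, 8, 16 — a frequency not
decaying below 1/2 as the ratio grows (at any fixed shape family) kills the KS engine.

NUMBERS. x_c(ℤ²) = 1/μ(ℤ²) with μ = 2.63815853… (BDGS2012 (1.14) enclosure [2.625622, 2.679193];
tree: 1/3 ≤ x_c ≤ 1/2 unconditionally, SAW.one_third_le_criticalFugacity /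
criticalFugacity_le_half); σ = 5/8; boundary exponent of r2 = 5/8; κ = 8/3; SLE_2.6666666666666665
boundary two-arm exponent 8/κ − 1 = 2; KS annulus constant C free (Cor. 2.7).

DEFINITION REQUESTS. None new. Notes for the librarian: (i) a plain-square 'admissible SAW cell
domain' U(S,δ) is inlined in KSAdmissibleG1 (interior of the union of closed δ-squares) — the tree's
CellDomain (corner-cut octagons, defn-CellDomain) is NOT used because the union of four cut octagons
leaves a diamond hole at every interior dual vertex, so CellDomain S δ is never simply connected
once S contains a 2×2 block; a named def SquareCellDomain with the API of
CellDomainDiscretisation.lean (meshDomain = S, discreteDomainGraph = induced subgraph, simple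
connectivity iff the complement of S is connected) would let r5 be shortened; (ii) KS Thm 1.5 as a
named fact over ConditionG1/ConditionG2 (wanted by every SAW/KS route) is still unvendored.

Novelty: NOVELTY (D-0021; search-before-claim done 2026-08-14: `lit search`/`--hybrid` "parafermionic
observable self-avoiding walk square lattice", "critical self-avoiding walk annulus crossing", `lit
frontier CriticalPhenomena --since 2020`, `lit bridges CriticalPhenomena --cross any`; reads:
arXiv:1110.1141 pp.1-2, arXiv:0708.0032 pp.14-15, arXiv:1707.09335 pp.2-8, arXiv:1109.3091 pp.2-9,
arXiv:1212.6215 p.28; barrier catalogue Literature/Barriers/CriticalPhenomena/*).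
Nearest prior art found:
(1) Smirnov2007ICM §5.3 (arXiv:0708.0032 p.14): the general scheme "a discrete observable with a
conformally covariant scaling limit + the martingale property => SLE_kappa"; p.15: covariant
candidates for kappa = 8/3 "were not yet observed in lattice models".
(2) DuminilCopinSmirnov2012 (arXiv:1007.0575): Lemma 1 (half of discrete Cauchy-Riemann at x_c,
sigma = 5/8, HEXAGONAL lattice), §4 ("F_delta ... seems to have non-trivial curl"), Conjecture 2
(boundary-normalised observable -> (phi'(z)/phi'(b))^{5/8}), "a major step toward Conjecture 1";
DuminilCopin2013Parafermion §13.3, Conj. 13.15-13.16 (O(n), n != 1 open; "n = 0 especially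
interesting").
(3) LawlerSchrammWerner2004SAW (arXiv:math/0204277 p.7, Prediction 1 p.17): SLE_{8/3} identification
CONDITIONAL on existence + conformal invariance of the limit; LawlerSchrammWerner2003 Prop. 5.2:
h_t'(W_t)^{5/8} is a local martingale iff kappa = 8/3 (the identification step this route uses).
(4) KemppainenSmirnov2017 (arXiv:1212.6215 Thm 1.5, §4):  [refs: 1110.1141, 0708.0032, 1707.09335, 1109.3091, 1212.6215, 1007.0575, math/0204277, DuminilCopinSmirnov2012, LawlerSchrammWerner2003, KemppainenSmirnov2017, BeatonGuttmannJensen2012, KennedyLawler2013]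

Barriers (technique_class: parafermionic-observable limit + KS-G2 tightness + martingale): BARRIERS (technique_class: parafermionic-observable limit + KS-G2 tightness + martingale;
explicitly: approximate discrete holomorphicity of
Literature.Probability.RandomPlanarGeometry.SAW.midEdgeParafermionicObservable on Z^2 with NO exact
lattice identity - outside HasExactVertexRelationZ2 and outside the hexagonal class 'vertex
relations + boundary values only'; precompactness via
Literature.Probability.RandomPlanarGeometry.ConditionG2 / KemppainenSmirnov2017 Thm 1.5;
identification via the LSW03 Prop. 5.2 conformal martingale. Catalogue
Literature/Barriers/CriticalPhenomena/*, decls verified with `lean search`.)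
- `Literature.Barriers.CriticalPhenomena.NienhuisWeightsExcludeVertexSAW`
(NienhuisWeightsExcludeVertexSAW_holds + audit theorem
Literature.Barriers.CriticalPhenomena.not_hasExactVertexRelationZ2, both PROVED): the technique
class HasExactVertexRelationZ2 - an exact DCS-Lemma-1-type local relation for the uniform Z^2
mid-edge observable - is EMPTY; holomorphicity on Z^2 forces Nienhuis/Yang-Baxter weights
(IkhlefCardy2009 §3, GlazmanManolescu2019 p.1). APPLIES to any proof of r2 ObservableLimit by an
exact lattice identity. EVADED in statement, not yet in method: r2 is about the scaling LIMIT (the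
barrier's own evasions_known), the guard NoExactVertexRelation is this theorem; honest caveat: no
approximate-holomorphicity technology for n = 0 on Z^2 exists in print - the bet is that the ~1e-3
local defect of the DCS stencil has vanishing curl under coarse-graining (

History (route lifecycle, newest last):
- 2026-08-14T13:39:52Z · BROKEN — Tight (stmt-CriticalPhenomena-0772, crux) refuted by Summit.CriticalPhenomena.SAWScalingLimit.Theorems.SAWParafermionTight_refuted (gate)
- 2026-08-16T14:43:05Z · LINT AUTOFIX route.multi-assembly: kept Assembly, dropped Assembly2 (gate:hygiene)
- 2026-08-17T13:42:04Z · CLOSED refuted — refuted:stmt-CriticalPhenomena-0772 (Tight) by Summit.CriticalPhenomena.SAWScalingLimit.Theorems.SAWParafermionTight_refuted (grace expired, auto-close) (gate)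

sub-problem: SAWScalingLimit · status: closed(refuted) · opened planner-plan-CriticalPhenomena-SAWScalingLimit-0 2026-08-13T19:10:18Z · rev 12 · ledger route-CriticalPhenomena-SAWParafermion
GENERATED by the gate from the ledger (D-0016/17). Provers cite these decls: `theorem foo : Summit.CriticalPhenomena.SAWScalingLimit.Theses.SAWParafermion.<Decl> := …` in Summits/CriticalPhenomena/SAWScalingLimit/Theorems/<Name>.lean.
-/

namespace Summit.CriticalPhenomena.SAWScalingLimit.Theses.SAWParafermion

open scoped BigOperators Topology Manifold Classical MeasureTheory ProbabilityTheory Matrix InnerProductSpace ComplexConjugate ContinuousMap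
open Filter Set Function TopologicalSpace MeasureTheory

attribute [summit_statement] _root_.SAWScalingLimit

/-- item stmt-CriticalPhenomena-0790 · crux · rank 2 · closed · moot by None · by planner
why it might fail: Open even on hex (DCS12 §4: 'non-trivial curl'); no exact Z² vertex relation (not_hasExactVertexRelationZ2). Typed with κ=1: boundary lattice effects persist in the SAW limit via a tangent-angle factor l(θ) (KennedyLawler2013), so F(z_δ)/F(b_δ) may converge only up to a b-dependent constant.
sources: DuminilCopinSmirnov2012 (§4 and Conjecture 2; arXiv:1007.0575 p.7 of held copy), KennedyLawler2013 (arXiv:1109.3091 pp.4-7: lattice correction l(θ) at the boundary), BeatonGuttmannJensen2012 (arXiv:1110.1141 p.2: DCS identity on Z² only asymptotic, lattice-dependent constants), GlazmanManolescu2019 (p.1), Literature.Barriers.CriticalPhenomena.not_hasExactVertexRelationZ2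
[crux] r2 (hardest, most informative; informal until defn SAWParafermionicObservable lands):
Duminil-Copin–Smirnov 2012 Conjecture 2 (arXiv:1007.0575 p.10) transposed to δZ^2 — for a Dobrushin
domain (Ω; a, b) with ∂Ω smooth near b, z ∈ Ω, and the critical square-lattice SAW parafermionic
observable F_δ(z) = Σ_{γ ⊂ Ω_δ SAW from a_δ to z} exp(-i(5/8)W(γ)) x_c^{|γ|} (W = total winding,
Literature.Probability.LatticeModels.winding of the mesh polyline; x_c =
Literature.Probability.RandomPlanarGeometry.SAW.criticalFugacity), one has F_δ(z_δ)/F_δ(b_δ) →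
(φ'(z)/φ'(b))^{5/8} as δ → 0+, where φ : Ω → ℍ is conformal with a ↦ ∞, b ↦ 0 (unique up to a
positive real factor, so the ratio is well defined). Vertex vs mid-edge version to be fixed by the
definition; either is acceptable. -/
@[route_item "route-CriticalPhenomena-SAWParafermion"]
def ObservableLimit : Prop :=
  ∀ (D : Literature.Probability.RandomPlanarGeometry.DobrushinDomain) (a a' b b' z w : ℝ → Literature.Probability.LatticeModels.Site 2) (z₀ : ℂ) (Φ : Literature.Probability.RandomPlanarGeometry.ConformalEquiv D.carrier UpperHalfPlane.upperHalfPlaneSet) (L : ℂ → ℂ) (c : ℂ), let F : ℝ → Literature.Probability.LatticeModels.Site 2 → Literature.Probability.LatticeModels.Site 2 → ℂ := fun δ p q => ∑' γ : Literature.Probability.RandomPlanarGeometry.SAW.DomainSAW D.carrier δ (a δ) p, if s(p, q) ∈ γ.walk.edges then 0 else Complex.exp (-Complex.I * (5 / 8 : ℂ) * (Literature.Probability.LatticeModels.winding (Literature.Probability.LatticeModels.meshPoint δ (a' δ) :: (γ.walk.support.map (Literature.Probability.LatticeModels.meshPoint δ)) ++ [Literature.Probability.LatticeModels.medialPoint δ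 s(p, q)]) : ℝ)) * (Literature.Probability.RandomPlanarGeometry.SAW.criticalFugacity : ℂ) ^ (γ.length + 1); Literature.Probability.RandomPlanarGeometry.SAW.IsEndpointApprox D a b → (∀ᶠ δ in nhdsWithin 0 (Set.Ioi 0), (Literature.Probability.LatticeModels.zdGraph 2).Adj (a δ) (a' δ) ∧ Literature.Probability.LatticeModels.meshPoint δ (a' δ) ∉ D.carrier ∧ (Literature.Probability.LatticeModels.zdGraph 2).Adj (b δ) (b' δ) ∧ Literature.Probability.LatticeModels.meshPoint δ (b' δ) ∉ D.carrier ∧ (Literature.Probability.LatticeModels.discreteDomainGraph D.carrier δ).Adj (z δ) (w δ)) → z₀ ∈ D.carrier → Filter.Tendsto (fun δ => Literature.Probability.LatticeModels.meshPoint δ (z δ)) (nhdsWithin 0 (Set.Ioi 0)) (nhds z₀) → Filter.Tendsto (fun x => ‖Φ x‖) (nhdsWithin (D.pt 0) D.carrier) Filter.atTop → Φ.HasBoundaryValue (D.pt 1) 0 → c ≠ 0 → Filter.Tendsto (deriv Φ) (nhdsWithin (D.pt 1) D.carrier) (nhds c) → ContinuousOn L D.carrier → (∀ x ∈ D.carrier,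 Complex.exp (L x) = deriv Φ x / c) → Filter.Tendsto L (nhdsWithin (D.pt 1) D.carrier) (nhds 0) → Filter.Tendsto (fun δ => (F δ (z δ) (w δ) + F δ (w δ) (z δ)) / F δ (b δ) (b' δ)) (nhdsWithin 0 (Set.Ioi 0)) (nhds (Complex.exp ((5 / 8 : ℂ) * L z₀)))

/-- item stmt-CriticalPhenomena-0783 · crux · rank 3 · open · by planner
why it might fail: Unconditional over arbitrary subsequential μ: print gives SLE_{8/3} only IF the limit is conformally covariant (LSW04 p.7, Prediction 1); on Z² the only embedding-sensitive inputs are r2 (open even on hex) or restriction-of-limit; embedding-blind arguments cannot give rotations (Beffara2008).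
sources: LawlerSchrammWerner2004SAW (arXiv:math/0204277 p.7; Prediction 1 p.17), LawlerSchrammWerner2003 (Prop. 5.2: h_t'(W_t)^{5/8} local martingale iff κ=8/3), DuminilCopinSmirnov2012 (Conjecture 1), Beffara2008 (arXiv:0708.3908 p.2), Literature.Barriers.CriticalPhenomena.EmbeddingModulusUniqueness
[crux] r3: identification of subsequential limits — for every Dobrushin domain D, endpoint
approximation (a_δ,b_δ), sequence s_n → 0+ and probability measure μ on CurveClass ℂ, if ∫ f∘curve
d(Literature.Probability.RandomPlanarGeometry.SAW.law D (s n) …) → ∫ f dμ for all bounded continuous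
f then μ is the chordal SLE_{8/3} law in D (Literature.Probability.RandomPlanarGeometry.IsSLELaw
(8/3) D μ). Obtained from r2 (observable limit) by the martingale principle (LSW03
arXiv:math/0209343 Prop. 5.2: κ = 8/3 is singled out by the 5/8-observable), or from restriction
(sibling route). -/
@[route_item "route-CriticalPhenomena-SAWParafermion"]
def SubseqIdentification : Prop :=
  ∀ (D : Literature.Probability.RandomPlanarGeometry.DobrushinDomain) (a b : ℝ → Literature.Probability.LatticeModels.Site 2), Literature.Probability.RandomPlanarGeometry.SAW.IsEndpointApprox D a b → ∀ (s : ℕ → ℝ) (μ : MeasureTheory.Measure (Literature.Probability.RandomPlanarGeometry.CurveClass ℂ)), Filter.Tendsto s Filter.atTop (nhdsWithin 0 (Set.Ioi 0)) → MeasureTheory.IsProbabilityMeasure μ → (∀ f : BoundedContinuousFunction (Literature.Probability.RandomPlanarGeometry.CurveClass ℂ) ℝ, Filter.Tendsto (fun n => ∫ γ, f γ.curve ∂(Literature.Probability.RandomPlanarGeometry.SAW.law D.carrier (s n) (a (s n)) (b (s n)))) Filter.atTop (nhds (∫ x, f x ∂μ))) → Literature.Probability.RandomPlanarGeometry.IsSLELaw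 ((8 : NNReal) / 3) D μ

/-- item stmt-CriticalPhenomena-0772 · crux · rank 4 · closed · refuted by Summit.CriticalPhenomena.SAWScalingLimit.Theorems.SAWParafermionTight_refuted (refuter) · by planner
why it might fail: REFUTED as typed (Theorems.SAWParafermionTight_refuted): IsTightLaws ranges over all δ∈(0,1], IsEndpointApprox only constrains δ→0⁺. Intended eventual tightness is open: no annulus-crossing/RSW bound for critical SAW in print (KS17 §4 omits SAW; sub-ballisticity DCH13 is strongest input).
sources: Summit.CriticalPhenomena.SAWScalingLimit.Theorems.SAWParafermionTight_refuted, KemppainenSmirnov2017 (arXiv:1212.6215 Thm 1.5, §4), DuminilCopinHammond2013 (arXiv:1205.0401)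
[crux] r3: tightness — for every Dobrushin domain and endpoint approximation, the family δ ↦
(Literature.Probability.RandomPlanarGeometry.SAW.law D δ a_δ b_δ).map curve, δ ∈ (0,1], is tight on
CurveClass ℂ (Literature.Probability.RandomPlanarGeometry.IsTightLaws). Intended tools:
Aizenman–Burchard regularity / Kemppainen–Smirnov arXiv:1212.6215 Thm 1.5 (Condition G2 ⇒ tightness)
— an annulus-crossing bound for the critical SAW that is not in print; sub-ballisticity
(Duminil-Copin–Hammond arXiv:1205.0401) is the strongest known input. Believed open. -/
@[route_item "route-CriticalPhenomena-SAWParafermion"]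
def Tight : Prop :=
  ∀ (D : Literature.Probability.RandomPlanarGeometry.DobrushinDomain) (a b : ℝ → Literature.Probability.LatticeModels.Site 2), Literature.Probability.RandomPlanarGeometry.SAW.IsEndpointApprox D a b → Literature.Probability.RandomPlanarGeometry.IsTightLaws (fun δ => (Literature.Probability.RandomPlanarGeometry.SAW.law D.carrier δ (a δ) (b δ)).map (fun γ => γ.curve))

/-- item stmt-CriticalPhenomena-1881 · crux · rank 4 · open · by planner
why it might fail: Open for SAW: no RSW/annulus-crossing bound at x_c (KS17 §4 verifies G2 only for FKG models; G2 fails for UST, §4.5); only sub-ballisticity (DCH13) is unconditional; as typed it must hold uniformly over arbitrary endpoint approximations (a δ, b δ).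
sources: KemppainenSmirnov2017 (arXiv:1212.6215 Thm 1.5, §4, §4.5), DuminilCopinHammond2013 (arXiv:1205.0401), AizenmanBurchardDuke1999, Summit.CriticalPhenomena.SAWScalingLimit.Theorems.SAWParafermionTight_refuted, Literature.Probability.RandomPlanarGeometry.IsTightAlongMesh
[support] EVENTUAL TIGHTNESS of the critical SAW laws: for every Dobrushin domain and endpoint
approximation, IsTightAlongMesh (fun δ γ => γ.curve) (fun δ => SAW.law D δ a_δ b_δ) — for every ε
some compact set of CurveClass ℂ carries all but ε of the mass for all small δ. This is the form the
Prokhorov criterion convergesInLawToSLE_of_isTightAlongMesh consumes and the repair of the refuted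
all-δ Tight (IsTightLaws over δ ∈ (0,1]) suggested by the refuting theorem; offered to routes
SAWParafermion / SAWConfRestriction as their restated r3/r4. -/
@[route_item "route-CriticalPhenomena-SAWParafermion"]
def EventualTight : Prop :=
  ∀ (D : Literature.Probability.RandomPlanarGeometry.DobrushinDomain) (a b : ℝ → Literature.Probability.LatticeModels.Site 2), Literature.Probability.RandomPlanarGeometry.SAW.IsEndpointApprox D a b → Literature.Probability.RandomPlanarGeometry.IsTightAlongMesh (fun δ (γ : Literature.Probability.RandomPlanarGeometry.SAW.DomainSAW D.carrier δ (a δ) (b δ)) => γ.curve) (fun δ => Literature.Probability.RandomPlanarGeometry.SAW.law D.carrier δ (a δ) (b δ))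

/-- item stmt-CriticalPhenomena-11346 · crux · rank 5 · closed · moot by None · by planner
why it might fail: No RSW/FKG at n=0 (KS17 §4 verifies G-conditions for FK, percolation, HE, LERW; UST fails G2, §4.5); a long-confined critical SAW's deep-fjord re-entry must stay ≤1/2 uniformly over ALL polyominoes and all scales ≥ δ; only sub-ballisticity (DCH13) is unconditional.
sources: KemppainenSmirnov2017 (arXiv:1212.6215 eq. (3)-(4) Condition G1; §2.1.3; §4.1.3-4.1.6 admissible domains and the t = 0 reduction; Prop. 2.6), DuminilCopinHammond2013 (arXiv:1205.0401), arXiv:1707.09335 (Prop. 8: FKG needs n ≥ 1), MadrasSlade1993 (§1.2, concatenation / domain Markov of SAW), Literature.Probability.RandomPlanarGeometry.ConditionG1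
[crux] r5 (RESTATED 2026-08-15; supersedes KSConditionG2 = stmt-CriticalPhenomena-0791):
Kemppainen–Smirnov's TIME-ZERO Condition G1 (arXiv:1212.6215 eq. (4);
Literature.Probability.RandomPlanarGeometry.ConditionG1) for the ADMISSIBLE family of critical
square-lattice SAW laws — there is C > 1 such that for every finite S ⊆ ℤ² inducing a connected
subgraph with connected complement (a simply connected polyomino), every mesh δ > 0, all boundary
vertices a, b of S, and every annulus A(z₀, r, R) with R ≥ C r, the critical SAW in S from a to b
(SAW.law of the plain square-cell domain U(S,δ) = interior ⋃_{v∈S} closed δ-squares, whose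
discretisation is the subgraph of ℤ² induced on S) makes a crossing of A contained in the avoidable
part A^u (KS eq. (3), computed in U(S,δ)) with probability ≤ 1/2. WHY THIS FORM: (i) it is KS's own
reduction (§4.1.6, proof of Prop. 4.3: 'at t = 2n the domain U_t is admissible, hence we can assume
t = 0 and consider all admissible domains') — the SAW has the exact domain Markov property S ↦ S ∖
{v₀,…,v_{k-1}}, tip v_k and target b stay boundary vertices, so G1 over the admissible family is the
substance of Condition G2 for the SAW; (ii) square cells make l -/
@[route_item "route-CriticalPhenomena-SAWParafermion"]
def KSAdmissibleG1 : Prop :=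
  Literature.Probability.RandomPlanarGeometry.ConditionG1 {L : Literature.Probability.RandomPlanarGeometry.MarkedLaw | ∃ (S : Finset (Literature.Probability.LatticeModels.Site 2)) (δ : ℝ) (a b : Literature.Probability.LatticeModels.Site 2), let U : Set ℂ := interior (⋃ v ∈ S, {z : ℂ | |z.re - (Literature.Probability.LatticeModels.meshPoint δ v).re| ≤ δ / 2 ∧ |z.im - (Literature.Probability.LatticeModels.meshPoint δ v).im| ≤ δ / 2}); 0 < δ ∧ ((Literature.Probability.LatticeModels.zdGraph 2).induce (↑S : Set (Literature.Probability.LatticeModels.Site 2))).Preconnected ∧ ((Literature.Probability.LatticeModels.zdGraph 2).induce ((↑S : Set (Literature.Probability.LatticeModels.Site 2))ᶜ)).Preconnected ∧ a ∈ S ∧ b ∈ S ∧ (∃ w ∉ S, (Literature.Probability.LatticeModels.zdGraph 2).Adj a w) ∧ (∃ w ∉ S, (Literature.Probability.LatticeModels.zdGraph 2).Adj b w) ∧ L = ⟨U, Literature.Probability.LatticeModels.meshPoint δ a, Literature.Probability.LatticeModels.meshPoint δ b, (Literature.Probability.RandomPlanarGeometry.SAW.law U δ a b).map (fun γ => γ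.curve)⟩}

/-- item stmt-CriticalPhenomena-0791 · support · rank 5 · closed · moot by None · by planner
why it might fail: No crossing technology at n=0: no FKG (parafermion crossing bounds of arXiv:1707.09335 need n≥1, Prop. 8); KS17 §4 verifies G2 for FK/percolation/HE/LERW only, G2 FAILS for UST (§4.5); strongest SAW input: sub-ballisticity (DCH13). As typed (all δ∈(0,1], all D) the family has interior-endpoint SAW.
sources: KemppainenSmirnov2017 (arXiv:1212.6215 §2.1.3 p.9, Thm 1.5, §4, §4.5 p.28), DuminilCopinHammond2013 (arXiv:1205.0401), arXiv:1707.09335 (Prop. 8: FKG of the cluster representation needs n≥1), arXiv:2310.17299 (quantitative sub-ballisticity, hexagonal lattice only), Literature.Probability.RandomPlanarGeometry.ConditionG2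
[crux] r5 (informal until defn KSCondition lands): the family {critical SAW law in (Ω_δ; a_δ, b_δ) :
Dobrushin domain, endpoint approximation, δ ∈ (0,1]}, together with its conditionings on initial
segments (the SAW has the domain Markov property in the slit discrete domain), satisfies
Kemppainen–Smirnov Condition G2 (arXiv:1212.6215 §2.1.3): there is C > 1 such that for every
stopping time τ and every annulus A(z; r, R) with R/r ≥ C not separating the tip from b in Ω_δ minus
γ[0,τ], the conditional probability of an unforced crossing of A is ≤ 1/2. Yields Tight (KS Thm 1.5)
and that subsequential limits are Loewner curves with continuous driving process (Cor. 1.7). -/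
@[route_item "route-CriticalPhenomena-SAWParafermion"]
def KSConditionG2 : Prop :=
  Literature.Probability.RandomPlanarGeometry.ConditionG2 {L : Literature.Probability.RandomPlanarGeometry.MarkedLaw | ∃ (D : Literature.Probability.RandomPlanarGeometry.DobrushinDomain) (a b : ℝ → Literature.Probability.LatticeModels.Site 2) (δ : ℝ), Literature.Probability.RandomPlanarGeometry.SAW.IsEndpointApprox D a b ∧ δ ∈ Set.Ioc (0 : ℝ) 1 ∧ L = ⟨D.carrier, Literature.Probability.LatticeModels.meshPoint δ (a δ), Literature.Probability.LatticeModels.meshPoint δ (b δ), (Literature.Probability.RandomPlanarGeometry.SAW.law D.carrier δ (a δ) (b δ)).map (fun γ => γ.curve)⟩}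

/-- item stmt-CriticalPhenomena-0792 · support · rank 9 · closed · moot by None · by planner
sources: Literature.Barriers.CriticalPhenomena.not_hasExactVertexRelationZ2, GlazmanManolescu2019 (p.1), IkhlefCardy2009 (§3)
[support] refutation guard / grounding note (informal): for the uniform-weight SAW on Z^2 there is
NO pair (x, σ) ∈ (0,1) × ℝ and no fixed finite stencil of complex coefficients c_e (depending only
on the direction of the mid-edge e around a vertex v) such that Σ_{e ∋ v} c_e F_δ^{x,σ}(e) = 0 holds
identically for all discrete domains, all boundary roots a and all interior vertices v (the Z^2
analogue of DCS Lemma 1 fails). Expected TRUE (Glazman–Manolescu arXiv:1708.00395 p.1: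
square-lattice SAW 'is not believed to be integrable'); a small-domain computer check can settle
small stencils. Purpose: steer provers of r2 away from exact identities and toward approximate/limit
statements. -/
@[route_item "route-CriticalPhenomena-SAWParafermion"]
def NoExactVertexRelation : Prop :=
  ¬ ∃ (x σ : ℝ) (c : Fin 4 → ℂ), 0 < x ∧ x < 1 ∧ c ≠ 0 ∧ ∀ (Ω : Set ℂ) (δ : ℝ) (a v : Literature.Probability.LatticeModels.Site 2), 0 < δ → a ∈ Literature.Probability.LatticeModels.meshDomain Ω δ → (∃ w : Literature.Probability.LatticeModels.Site 2, (Literature.Probability.LatticeModels.zdGraph 2).Adj a w ∧ Literature.Probability.LatticeModels.meshPoint δ w ∉ Ω) → (∀ i : Fin 4, (Literature.Probability.LatticeModels.discreteDomainGraph Ω δ).Adj v (v + (![![1, 0], ![0, 1], ![-1, 0], ![0, -1]] : Fin 4 → Literature.Probability.LatticeModels.Site 2) i)) → ∑ i : Fin 4, c i * Literature.Probability.RandomPlanarGeometry.SAW.midEdgeParafermionicObservable Ω δ a x σ s(v, v + (![![1, 0], ![0, 1], ![-1, 0], ![0, -1]] : Fin 4 → Literature.Probability.LatticeModels.Site 2)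 i) = 0

-- TODO item stmt-CriticalPhenomena-4538 · support · rank 9 · closed · proved by Summit.CriticalPhenomena.SAWScalingLimit.Theorems.frontierHomotopy_tightIdentificationGlue_proof @ cf29ad9b5131 (prover) · by planner — BLOCKED: missing decl(s) EventualTight; restate via `ledger route edit` once they land:
--   def TightIdentificationGlue : Prop := EventualTight → SubseqIdentification → SAWScalingLimit

/-- item stmt-CriticalPhenomena-0784 · assembly · rank 1 · closed · proved by Summit.CriticalPhenomena.SAWScalingLimit.Theorems.parafermion_assembly_proof (prover) · by planner
[assembly] Literature.Probability.RandomPlanarGeometry.CurveClass.polishSpace →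
Literature.Probability.RandomPlanarGeometry.IsSLECurve.map_eq →
Literature.Probability.RandomPlanarGeometry.exists_isSLECurve → Tight → SubseqIdentification →
SAWScalingLimit. Proof: laws are eventually probability measures (IsEndpointApprox.reachable,
finiteness of DomainSAW for bounded Ω); Prokhorov (Polish + tight) gives subsequential weak limits
along any δ_n → 0+; SubseqIdentification makes each the SLE_{8/3} law, unique by map_eq and realised
as preWienerMeasure.map Γ by exists_isSLECurve; the subsequence principle for the first-countable
filter 𝓝[>]0 gives TendstoLaw … Γ preWienerMeasure, hence ConvergesInLawToSLE. -/
@[route_item "route-CriticalPhenomena-SAWParafermion"]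
def Assembly : Prop :=
  SubseqIdentification → EventualTight → SAWScalingLimit

-- records of items no longer active in this route (dropped / restated):
-- earlier Assembly2 (stmt-CriticalPhenomena-10209, dropped 2026-08-16T14:43:05Z): proved by Summit.CriticalPhenomena.SAWScalingLimit.Theorems.parafermion_assembly2_proof — ∀ (D : Literature.Probability.RandomPlanarGeometry.DobrushinDomain) (a b : ℝ → Literature.Probability.LatticeModels.Site 2), Literature.Probability.RandomPlanarGeometry.SAW.IsEndpointApprox D a b → Literature.Probability.RandomPla

end Summit.CriticalPhenomena.SAWScalingLimit.Theses.SAWParafermion
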